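import Literature.Probability.Percolation.DecisionTreeGenerating
import HarnessLib

/-!
# Tying monotonicity: the Dubey–Sahi n-function Harris inequality (Theorem D), also along
# generating decision trees (Dubey–Sahi 2025, Thms D, E; Gladkov 2024, Main Lemma 8.1)

Topic `Literature/Probability/Percolation`. Sources: P. Dubey, S. Sahi, *Simultaneous elections in a
polarized society make single-party sweeps more likely*, arXiv:2503.01663v2 (26 Apr 2025) [DubeySahi2025],
§2, Definitions 1–3, Theorem D (p. 7) and its proof (pp. 7–8), Theorem E (pp. 8–9); N. Gladkov,
*Percolation Inequalities and Decision Trees*, arXiv:2408.08457v2 (2024) [Gladkov2024], Main Lemma 8.1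
(formalised in `DecisionTreeGenerating.lean`).

THE PRINTED SETTING (verbatim, [DubeySahi2025, §2]).  "Let `L = {1, …, n}` be a finite set, let `π` be a
partition of `L` … Given `0 ≤ p ≤ 1`, construct a random subset `S ∈ 𝓛` as follows: for each `M` in `π`,
toss a coin with probability `p` of heads; if heads then include `M` in `S`." (Def. 1: `μ_{π,p}`).  "We say
that `F = (f₁, …, fₙ)` is an aligned tuple of functions on `𝓗` if, for each `h ∈ H`, either all the
`f_l` are increasing at `h`, or all are decreasing at `h`." (Def. 2).  With `Π = (π₁, …, π_m)` (one
partition of `L` per coordinate `h ∈ H = {1,…,m}`) and `p = (p₁,…,p_m)`,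
`μ_{Π,p}(L₁,…,L_m) := μ_{π₁,p₁}(L₁)⋯μ_{π_m,p_m}(L_m)`, `F̄(H₁,…,Hₙ) := f₁(H₁)⋯fₙ(Hₙ)` and
`𝓔(Π,p,F) := Σ_T F̄(T) μ_{Π,p}(T)` (Def. 3).

**Theorem D** [DubeySahi2025, p. 7]: "Suppose `F = (f₁, …, fₙ)` is an aligned tuple of nonnegative
functions on `𝓗`. If `Π′` is coarser than `Π` then we have `𝓔(Π′,p,F) ≥ 𝓔(Π,p,F)` for all `p`."
Proof (pp. 7–8): reduce to merging two blocks `M₁, M₂` of one `π_h`; conditionally on the other tosses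
the two expectations are `A = [p a₁a₂ + (1−p) b₁b₂]c` and
`B = [p²a₁a₂ + p(1−p)(a₁b₂ + b₁a₂) + (1−p)²b₁b₂]c`, and "`A − B = p(1−p)(a₁ − b₁)(a₂ − b₂)c` … since the
`fᵢ` are aligned … `(a₁ − b₁)(a₂ − b₂) ≥ 0`".  **Theorem E** (pp. 8–9): the case `n = 2`,
`Π = ({1},{2})` everywhere versus `Π′ = ({1,2})` everywhere, is Harris' inequality
`E(f₁f₂) ≥ E(f₁)E(f₂)`; "Thus Theorem D can be regarded as an `n`-function generalization of the Harris
inequality."  Footnote 6 (p. 5): "One of the authors of the present paper has proposed a different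
generalization of the FKG inequality to `n` functions [Sahi 2008] … However the general problem remains
open, and seems much harder than the generalization considered here" — recorded for the status of Sahi's
`E_n`-conjecture (`SahiThirdOrderCorrelation.lean`), which this file does NOT touch.

WHAT IS HERE (all PROVED; finitary weighted calculus of `DecisionTreeGenerating.lean`):
* `Tying.copy l C` — the `l`-th of the `n` coupled configurations (`C : ι → (L → Bool)`, coordinates
  `ι` = the printed `H`, copies `L`); `Tying.tied c q` — the one-coordinate law `μ_{π,q}` on `L → Bool`
  for the partition of `L` presented as a COLOURING `c : L → K` by coins (copies of one colour share one
  `q`-coin): the push-forward of independent `q`-coins `K → Bool` along `y ↦ y ∘ c`.  A partition `π′`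
  coarser than `π` is a colouring `g ∘ c` (`g : K → K'` merges coins).  `tied_nonneg`.
* `Tying.sum_tied_mul_prod` — the one-coordinate computation
  `Σ_x μ_{c,q}(x) ∏_l φ_l(x_l) = ∏_k (q ∏_{c l = k} φ_l(1) + (1−q) ∏_{c l = k} φ_l(0))`;
  `Tying.prod_twoPoint_le` — `∏_k (qA_k + (1−q)B_k) ≤ q∏A_k + (1−q)∏B_k` for `0 ≤ B ≤ A` (the printed
  `A − B = p(1−p)(a₁−b₁)(a₂−b₂)c ≥ 0`, iterated); **`Tying.sum_tied_mul_prod_le_coarser`** — the merged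
  (coarser) colouring has the larger one-coordinate expectation for aligned nonnegative `φ`.
* **`Tying.resampleLE_coarser`** — hence Gladkov's condition (18) holds between `μ₁ = (μ_{c_e, p_e})_e`
  and `μ₂ = (μ_{g_e ∘ c_e, p_e})_e` for the product functional `F̄ = ∏_l f_l ∘ copy l` of an aligned
  nonnegative tuple (alignment may vary with the coordinate, as printed);
  **`Tying.thmD`** — THEOREM D: `𝓔(Π,p,F) ≤ 𝓔(Π′,p,F)` (`DecisionTree.Ex` of the finer ≤ of the
  coarser weights); **`Tying.thmD_tree`** — NEW PACKAGING, immediate from Main Lemma 8.1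
  (`GTree.ex_le_eval`, `GTree.eval_le_ex`): for every generating decision tree `T` that draws each
  coordinate's `n` bits from the finer OR the coarser law adaptively, `𝓔(Π,p,F) ≤ P_T(F̄) ≤ 𝓔(Π′,p,F)` —
  the tying analogue of Gladkov's Theorems 3.2 / 8.7 (theorem-grade "hybrid" rows of every degree `n`).
* Identifications: `DecisionTree.ex_pushWeights` (expectation under a coordinatewise push-forward `pushWeights`);
  `Tying.ex_allTied` — all copies on one coin (`K = Unit`): `𝓔 = E_p[∏_l f_l]`, the one-sample
  expectation (`Ex` of the Bernoulli weights `bern p`); `Tying.ex_allFree` — every copy its own coin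
  (`c = id`): `𝓔 = ∏_l E_p[f_l]`.  Hence **`Tying.prod_ex_le_ex_tied_le_ex_prod`**: for EVERY tying
  pattern, `∏_l E_p[f_l] ≤ 𝓔(Π,p,F) ≤ E_p[∏_l f_l]`, and **`Tying.harris_prod`** (Theorem E for `n`
  functions): `∏_l E_p[f_l] ≤ E_p[∏_l f_l]` for an aligned nonnegative tuple — `n = 2` is Harris.

Design notes.  Partitions are colourings (no `Finpartition`); "coarser" = post-composition; the printed
`p_h ∈ [0,1]` per coordinate is `p : ι → ℝ` with `0 ≤ p ≤ 1`; "increasing at `h`" is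
`f (g[h ↦ 0]) ≤ f (g[h ↦ 1])` for all `g`.  The printed reduction "add a constant to make `f` nonnegative"
of Theorem E is not repeated (we state Harris for nonnegative aligned pairs; the tree already has Harris in
full generality, e.g. `Literature.Probability.Percolation.harris_fkg_holds`).  Not here: the election model
(Theorems A–C are Theorem D read on win-probability functions), party alliances (§3.3).

## References
* P. Dubey, S. Sahi, *Simultaneous elections in a polarized society make single-party sweeps more likely*,
  arXiv:2503.01663v2 (2025), §2: Defs 1–3, Thm D, Thm E, footnote 6. [DubeySahi2025]
* N. Gladkov, *Percolation Inequalities and Decision Trees*, arXiv:2408.08457v2 (2024), Main Lemma 8.1. [Gladkov2024]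
-/

noncomputable section

open Classical

namespace Literature.Probability.Percolation

namespace DecisionTree

open Finset Function

variable {ι : Type*} [Fintype ι] [DecidableEq ι]

/-! ### Push-forward of coordinatewise weights -/
section Pushforward

variable {Ω : Type*} [Fintype Ω] [DecidableEq Ω] {Ω' : Type*} [Fintype Ω'] [DecidableEq Ω']

/-- The coordinatewise push-forward of weights `ν` on `Ω'` along maps `φ i : Ω' → Ω`:
`(φ_* ν) i x = Σ_{y : φ i y = x} ν i y`. [folklore] -/
def pushWeights (φ : ι → Ω' → Ω) (ν : ι → Ω' → ℝ) (i : ι) (x : Ω) : ℝ :=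
  ∑ y, ν i y * (if x = φ i y then 1 else 0)

omit [Fintype ι] [DecidableEq ι] [Fintype Ω] [DecidableEq Ω'] in
/-- Push-forward weights of nonnegative weights are nonnegative. [folklore] -/
theorem pushWeights_nonneg {φ : ι → Ω' → Ω} {ν : ι → Ω' → ℝ} (hν : ∀ i y, 0 ≤ ν i y) (i : ι) (x : Ω) :
    0 ≤ pushWeights φ ν i x :=
  sum_nonneg fun y _ => mul_nonneg (hν i y) (by split_ifs <;> norm_num)

omit [DecidableEq Ω'] in
/-- **Expectation under a coordinatewise push-forward**: `Ex (φ_* ν) f = Ex ν (f ∘ (φ ∘ ·))`.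
[folklore] -/
theorem ex_pushWeights (φ : ι → Ω' → Ω) (ν : ι → Ω' → ℝ) (f : (ι → Ω) → ℝ) :
    Ex (pushWeights φ ν) f = Ex ν (fun C' => f (fun i => φ i (C' i))) := by
  unfold Ex pushWeights
  -- expand the product of sums into a sum over `Y : ι → Ω'`
  have hexp : ∀ C : ι → Ω,
      (∏ i, ∑ y, ν i y * (if C i = φ i y then (1 : ℝ) else 0)) * f C =
        ∑ Y : ι → Ω', (∏ i, ν i (Y i)) * ((if C = fun i => φ i (Y i) then (1 : ℝ) else 0) * f C) := by
    intro C
    rw [Fintype.prod_sum, sum_mul]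
    refine sum_congr rfl fun Y _ => ?_
    rw [prod_mul_distrib]
    have hind : (∏ i, (if C i = φ i (Y i) then (1 : ℝ) else 0)) =
        if C = fun i => φ i (Y i) then 1 else 0 := by
      by_cases h : C = fun i => φ i (Y i)
      · rw [if_pos h]
        exact prod_eq_one fun i _ => by rw [if_pos (congrFun h i)]
      · rw [if_neg h]
        obtain ⟨i, hi⟩ := Function.ne_iff.1 h
        exact prod_eq_zero (mem_univ i) (by rw [if_neg hi])
    rw [hind]
    ring
  simp_rw [hexp]
  rw [sum_comm]
  refine sum_congr rfl fun Y _ => ?_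
  rw [← mul_sum]
  congr 1
  rw [show (∑ C : ι → Ω, (if C = fun i => φ i (Y i) then (1 : ℝ) else 0) * f C) =
      ∑ C : ι → Ω, (if C = fun i => φ i (Y i) then f C else 0) from
    sum_congr rfl fun C _ => by split_ifs <;> simp]
  rw [sum_ite_eq' univ (fun i => φ i (Y i))]
  simp

end Pushforward

/-! ### Bernoulli weights and product alphabets -/
section Bern

/-- The Bernoulli weights of one bit per coordinate: `bern p i b = p i` for `b = 1`, `1 - p i` for `b = 0`
("`μ(S) = ∏_{h ∈ S} p_h ∏_{h ∉ S} (1 − p_h)`"). [cite: DubeySahi2025, Theorem E (p. 8)] -/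
def bern (p : ι → ℝ) (i : ι) (b : Bool) : ℝ := Richards.bw (p i) b

omit [Fintype ι] [DecidableEq ι] in
/-- `bern p ≥ 0` for `p ∈ [0,1]`. [folklore] -/
theorem bern_nonneg {p : ι → ℝ} (hp0 : ∀ i, 0 ≤ p i) (hp1 : ∀ i, p i ≤ 1) (i : ι) (b : Bool) :
    0 ≤ bern p i b :=
  Richards.bw_nonneg (hp0 i) (hp1 i) b

omit [Fintype ι] [DecidableEq ι] in
/-- `bern p` has total mass one. [folklore] -/
theorem sum_bern (p : ι → ℝ) (i : ι) : ∑ b, bern p i b = 1 := by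
  simp [bern, Richards.bw]

end Bern

namespace Tying

variable {L : Type*} [Fintype L] [DecidableEq L]
variable {K : Type*} [Fintype K] [DecidableEq K] {K' : Type*} [Fintype K'] [DecidableEq K']

/-! ### Copies, tied weights -/

/-- The `l`-th coupled configuration ("the configuration `H_l`", `θ(H₁,…,Hₙ)` of Def. 2/3): coordinate
`i` of copy `l` is the `l`-th bit drawn at `i`. [cite: DubeySahi2025, §2 (the bijection θ)] -/
def copy (l : L) (C : ι → (L → Bool)) : ι → Bool := fun i => C i l

omit [Fintype ι] [Fintype L] [DecidableEq L] in
/-- Updating the joint configuration at `e` updates every copy at `e`. [folklore] -/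
theorem copy_update (l : L) (C : ι → (L → Bool)) (e : ι) (x : L → Bool) :
    copy l (update C e x) = update (copy l C) e (x l) := by
  funext i
  by_cases h : i = e
  · subst h; simp [copy]
  · simp [copy, h]

/-- The one-coordinate TIED law `μ_{π,q}` for the partition of the copies `L` presented by the colouring
`c : L → K`: independent `q`-coins `y : K → Bool`, copy `l` receives `y (c l)` ("for each `M` in `π`,
toss a coin with probability `p` of heads; if heads then include `M` in `S`").
[cite: DubeySahi2025, Definition 1] -/
def tied (c : L → K) (q : ℝ) (x : L → Bool) : ℝ :=
  ∑ y : K → Bool, (∏ k, Richards.bw q (y k)) * (if x = y ∘ c then 1 else 0)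

omit [Fintype ι] [DecidableEq ι] [DecidableEq L] in
/-- `tied c q` is the push-forward of independent coins along `y ↦ y ∘ c`. [folklore] -/
theorem tied_eq_pushWeights (c : ι → L → K) (p : ι → ℝ) :
    (fun e => tied (c e) (p e)) =
      pushWeights (fun e (y : K → Bool) => y ∘ c e) (fun e (y : K → Bool) => ∏ k, Richards.bw (p e) (y k)) := by
  funext e x
  rfl

omit [Fintype ι] [DecidableEq ι] [DecidableEq L] in
/-- `tied c q ≥ 0` for `q ∈ [0,1]`. [folklore] -/
theorem tied_nonneg (c : L → K) {q : ℝ} (hq0 : 0 ≤ q) (hq1 : q ≤ 1) (x : L → Bool) :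
    0 ≤ tied c q x :=
  sum_nonneg fun y _ => mul_nonneg (prod_nonneg fun k _ => Richards.bw_nonneg hq0 hq1 (y k))
    (by split_ifs <;> norm_num)

/-! ### The one-coordinate computation and the merging inequality -/

/-- **One-coordinate expectation of a product under the tied law**:
`Σ_x μ_{c,q}(x) ∏_l φ_l(x_l) = ∏_k (q · ∏_{c l = k} φ_l(1) + (1 − q) · ∏_{c l = k} φ_l(0))`
(the factors `p a₁ + (1−p) b₁`, … of the printed proof). [cite: DubeySahi2025, Theorem D (proof, p. 7)] -/
theorem sum_tied_mul_prod (c : L → K) (q : ℝ) (φ : L → Bool → ℝ) :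
    ∑ x, tied c q x * ∏ l, φ l (x l) =
      ∏ k, (q * ∏ l ∈ univ.filter (fun l => c l = k), φ l true +
        (1 - q) * ∏ l ∈ univ.filter (fun l => c l = k), φ l false) := by
  unfold tied
  -- collapse the sum over `x` onto `x = y ∘ c`
  have h1 : ∑ x : L → Bool, (∑ y : K → Bool, (∏ k, Richards.bw q (y k)) *
      (if x = y ∘ c then (1 : ℝ) else 0)) * ∏ l, φ l (x l) =
      ∑ y : K → Bool, (∏ k, Richards.bw q (y k)) * ∏ l, φ l (y (c l)) := by
    simp_rw [sum_mul]
    rw [sum_comm]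
    refine sum_congr rfl fun y _ => ?_
    rw [show (∑ x : L → Bool, (∏ k, Richards.bw q (y k)) * (if x = y ∘ c then (1 : ℝ) else 0) *
        ∏ l, φ l (x l)) = ∑ x : L → Bool, (if x = y ∘ c then (∏ k, Richards.bw q (y k)) *
        ∏ l, φ l (x l) else 0) from sum_congr rfl fun x _ => by split_ifs <;> simp]
    rw [sum_ite_eq' univ (y ∘ c)]
    simp [Function.comp]
  rw [h1]
  -- regroup `∏_l φ_l(y (c l))` by fibres of `c` and factor the sum over `y`
  have h2 : ∀ y : K → Bool, (∏ l, φ l (y (c l))) =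
      ∏ k, ∏ l ∈ univ.filter (fun l => c l = k), φ l (y k) := by
    intro y
    rw [← prod_fiberwise univ c (fun l => φ l (y (c l)))]
    refine prod_congr rfl fun k _ => prod_congr rfl fun l hl => ?_
    rw [(mem_filter.1 hl).2]
  simp_rw [h2, ← prod_mul_distrib]
  rw [← Fintype.prod_sum (fun k b => Richards.bw q b * ∏ l ∈ univ.filter (fun l => c l = k), φ l b)]
  refine prod_congr rfl fun k _ => ?_
  rw [Fintype.sum_bool]
  simp [Richards.bw]

omit [Fintype K] in
/-- **The merging inequality** ("`A − B = p(1−p)(a₁−b₁)(a₂−b₂)c ≥ 0`", iterated over a block of coins):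
for `q ∈ [0,1]` and `0 ≤ B_k ≤ A_k`, `∏_{k ∈ s} (qA_k + (1−q)B_k) ≤ q ∏_{k∈s} A_k + (1−q) ∏_{k∈s} B_k`.
[cite: DubeySahi2025, Theorem D (proof, pp. 7–8)] -/
theorem prod_twoPoint_le (s : Finset K) {q : ℝ} (hq0 : 0 ≤ q) (hq1 : q ≤ 1) {A B : K → ℝ}
    (hB : ∀ k, 0 ≤ B k) (hAB : ∀ k, B k ≤ A k) :
    ∏ k ∈ s, (q * A k + (1 - q) * B k) ≤ q * ∏ k ∈ s, A k + (1 - q) * ∏ k ∈ s, B k := by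
  induction s using Finset.induction_on with
  | empty => simp
  | @insert j s hj ih =>
      rw [prod_insert hj, prod_insert hj, prod_insert hj]
      have hA : ∀ k, 0 ≤ A k := fun k => (hB k).trans (hAB k)
      have hPA : 0 ≤ ∏ k ∈ s, A k := prod_nonneg fun k _ => hA k
      have hPB : 0 ≤ ∏ k ∈ s, B k := prod_nonneg fun k _ => hB k
      have hPAB : ∏ k ∈ s, B k ≤ ∏ k ∈ s, A k :=
        prod_le_prod (fun k _ => hB k) fun k _ => hAB k
      have hfac : 0 ≤ q * A j + (1 - q) * B j :=
        add_nonneg (mul_nonneg hq0 (hA j)) (mul_nonneg (by linarith) (hB j))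
      calc (q * A j + (1 - q) * B j) * ∏ k ∈ s, (q * A k + (1 - q) * B k)
          ≤ (q * A j + (1 - q) * B j) * (q * ∏ k ∈ s, A k + (1 - q) * ∏ k ∈ s, B k) :=
            mul_le_mul_of_nonneg_left ih hfac
        _ ≤ q * (A j * ∏ k ∈ s, A k) + (1 - q) * (B j * ∏ k ∈ s, B k) := by
            have h1q : 0 ≤ 1 - q := by linarith
            nlinarith [mul_nonneg (mul_nonneg hq0 h1q) (mul_nonneg (sub_nonneg.2 (hAB j))
              (sub_nonneg.2 hPAB))]

omit [Fintype K] in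
/-- The merging inequality for the other alignment (`0 ≤ A_k ≤ B_k`). [cite: DubeySahi2025, Theorem D (proof)] -/
theorem prod_twoPoint_le' (s : Finset K) {q : ℝ} (hq0 : 0 ≤ q) (hq1 : q ≤ 1) {A B : K → ℝ}
    (hA : ∀ k, 0 ≤ A k) (hBA : ∀ k, A k ≤ B k) :
    ∏ k ∈ s, (q * A k + (1 - q) * B k) ≤ q * ∏ k ∈ s, A k + (1 - q) * ∏ k ∈ s, B k := by
  have h := prod_twoPoint_le s (q := 1 - q) (by linarith) (by linarith) hA hBA
  have e1 : ∀ k, (1 - q) * B k + (1 - (1 - q)) * A k = q * A k + (1 - q) * B k := fun k => by ring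
  simp_rw [e1] at h
  linarith

/-- **The coarser colouring has the larger one-coordinate expectation** for an aligned nonnegative
tuple: with `π′ = ` the partition of `g ∘ c` (blocks of `c` merged along `g`),
`Σ_x μ_{c,q}(x) ∏_l φ_l(x_l) ≤ Σ_x μ_{g∘c,q}(x) ∏_l φ_l(x_l)`.
[cite: DubeySahi2025, Theorem D (proof, pp. 7–8)] -/
theorem sum_tied_mul_prod_le_coarser (c : L → K) (g : K → K') {q : ℝ} (hq0 : 0 ≤ q) (hq1 : q ≤ 1)
    (φ : L → Bool → ℝ) (hφ : ∀ l b, 0 ≤ φ l b)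
    (halign : (∀ l, φ l false ≤ φ l true) ∨ (∀ l, φ l true ≤ φ l false)) :
    ∑ x, tied c q x * ∏ l, φ l (x l) ≤ ∑ x, tied (g ∘ c) q x * ∏ l, φ l (x l) := by
  rw [sum_tied_mul_prod, sum_tied_mul_prod]
  set A : K → ℝ := fun k => ∏ l ∈ univ.filter (fun l => c l = k), φ l true with hA
  set B : K → ℝ := fun k => ∏ l ∈ univ.filter (fun l => c l = k), φ l false with hB
  -- the fibres of `g ∘ c` are unions of fibres of `c`
  have hfib : ∀ (b : Bool) (k' : K'),
      (∏ l ∈ univ.filter (fun l => (g ∘ c) l = k'), φ l b) =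
        ∏ k ∈ univ.filter (fun k => g k = k'), ∏ l ∈ univ.filter (fun l => c l = k), φ l b := by
    intro b k'
    rw [← prod_fiberwise_of_maps_to (s := univ.filter (fun l => (g ∘ c) l = k'))
      (t := univ.filter (fun k => g k = k')) (g := c)
      (fun l hl => mem_filter.2 ⟨mem_univ _, (mem_filter.1 hl).2⟩) (fun l => φ l b)]
    refine prod_congr rfl fun k hk => prod_congr ?_ fun _ _ => rfl
    ext l
    simp only [mem_filter, mem_univ, true_and, Function.comp]
    constructor
    · rintro ⟨_, h⟩; exact h
    · intro h; exact ⟨by rw [h]; exact (mem_filter.1 hk).2, h⟩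
  simp_rw [hfib]
  -- regroup the left product by fibres of `g`
  rw [← prod_fiberwise univ g (fun k => q * A k + (1 - q) * B k)]
  have hA0 : ∀ k, 0 ≤ A k := fun k => prod_nonneg fun l _ => hφ l true
  have hB0 : ∀ k, 0 ≤ B k := fun k => prod_nonneg fun l _ => hφ l false
  refine prod_le_prod (fun k' _ => prod_nonneg fun k _ =>
    add_nonneg (mul_nonneg hq0 (hA0 k)) (mul_nonneg (by linarith) (hB0 k))) fun k' _ => ?_
  rcases halign with hinc | hdec
  · exact prod_twoPoint_le _ hq0 hq1 hB0 fun k => prod_le_prod (fun l _ => hφ l false) fun l _ => hinc l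
  · exact prod_twoPoint_le' _ hq0 hq1 hA0 fun k => prod_le_prod (fun l _ => hφ l true) fun l _ => hdec l

/-! ### Condition (18) and Theorem D -/

variable (p : ι → ℝ)

/-- The product functional `F̄(T) = f₁(H₁)⋯fₙ(Hₙ)` of a tuple of functions of one configuration each.
[cite: DubeySahi2025, Definition 3] -/
def prodFun (f : L → (ι → Bool) → ℝ) (C : ι → (L → Bool)) : ℝ := ∏ l, f l (copy l C)

/-- An ALIGNED tuple: at each coordinate `e`, all `f_l` are increasing at `e` or all are decreasing at
`e`. [cite: DubeySahi2025, Definition 2] -/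
def Aligned (f : L → (ι → Bool) → ℝ) : Prop :=
  ∀ e : ι, (∀ l g, f l (update g e false) ≤ f l (update g e true)) ∨
    (∀ l g, f l (update g e true) ≤ f l (update g e false))

omit [Fintype ι] in
/-- **Gladkov's condition (18) between a tying pattern and a coarsening of it**: for an aligned nonnegative
tuple, resampling one coordinate's `n` bits from the coarser tied law (`g_e ∘ c_e`) rather than the finer
(`c_e`) does not decrease the conditional expectation of `F̄`.
[cite: DubeySahi2025, Theorem D (proof)] [cite: Gladkov2024, Main Lemma 8.1 (18)] -/
theorem resampleLE_coarser (hp0 : ∀ i, 0 ≤ p i) (hp1 : ∀ i, p i ≤ 1) (c : ι → L → K) (g : ι → K → K')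
    {f : L → (ι → Bool) → ℝ} (hf0 : ∀ l h, 0 ≤ f l h) (hal : Aligned f) :
    ResampleLE (fun e => tied (c e) (p e)) (fun e => tied (g e ∘ c e) (p e)) (prodFun f) := by
  intro C e
  unfold prodFun
  simp_rw [copy_update]
  refine sum_tied_mul_prod_le_coarser (c e) (g e) (hp0 e) (hp1 e)
    (fun l b => f l (update (copy l C) e b)) (fun l b => hf0 l _) ?_
  rcases hal e with h | h
  · exact Or.inl fun l => h l _
  · exact Or.inr fun l => h l _

/-- **Theorem D (Dubey–Sahi 2025): tying monotonicity.**  For an aligned tuple of nonnegative functions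
`f_l : {0,1}^ι → ℝ`, coordinate probabilities `p ∈ [0,1]^ι`, a tying pattern `Π = (c_e)_e` (at coordinate
`e`, copies of one colour under `c_e : L → K` share one `p_e`-coin) and a coarsening `Π′ = (g_e ∘ c_e)_e`:
`𝓔(Π,p,F) ≤ 𝓔(Π′,p,F)`. [cite: DubeySahi2025, Theorem D] -/
theorem thmD (hp0 : ∀ i, 0 ≤ p i) (hp1 : ∀ i, p i ≤ 1) (c : ι → L → K) (g : ι → K → K')
    {f : L → (ι → Bool) → ℝ} (hf0 : ∀ l h, 0 ≤ f l h) (hal : Aligned f) :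
    Ex (fun e => tied (c e) (p e)) (prodFun f) ≤ Ex (fun e => tied (g e ∘ c e) (p e)) (prodFun f) :=
  ex_le_ex (resampleLE_coarser p hp0 hp1 c g hf0 hal) (fun e x => tied_nonneg (c e) (hp0 e) (hp1 e) x)
    fun e x => tied_nonneg (g e ∘ c e) (hp0 e) (hp1 e) x

/-- **Theorem D along a generating decision tree** (Dubey–Sahi's Theorem D combined with Gladkov's Main
Lemma 8.1): for every generating tree `T` valid on all coordinates that draws each coordinate's `n` bits
from the FINER tied law (decision `false`) or the COARSER one (decision `true`) — adaptively, depending on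
the bits drawn so far — `𝓔(Π,p,F) ≤ P_T(F̄) ≤ 𝓔(Π′,p,F)`.
[cite: DubeySahi2025, Theorem D] [cite: Gladkov2024, Main Lemma 8.1 (19)] -/
theorem thmD_tree (hp0 : ∀ i, 0 ≤ p i) (hp1 : ∀ i, p i ≤ 1) (c : ι → L → K) (g : ι → K → K')
    {f : L → (ι → Bool) → ℝ} (hf0 : ∀ l h, 0 ≤ f l h) (hal : Aligned f)
    {T : GTree ι (L → Bool)} (hT : T.ValidOn univ) (C : ι → (L → Bool)) :
    Ex (fun e => tied (c e) (p e)) (prodFun f) ≤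
        T.eval (fun e => tied (c e) (p e)) (fun e => tied (g e ∘ c e) (p e)) univ (prodFun f) C ∧
      T.eval (fun e => tied (c e) (p e)) (fun e => tied (g e ∘ c e) (p e)) univ (prodFun f) C ≤
        Ex (fun e => tied (g e ∘ c e) (p e)) (prodFun f) :=
  ⟨GTree.ex_le_eval (resampleLE_coarser p hp0 hp1 c g hf0 hal)
      (fun e x => tied_nonneg (c e) (hp0 e) (hp1 e) x) (fun e x => tied_nonneg (g e ∘ c e) (hp0 e) (hp1 e) x)
      hT C,
    GTree.eval_le_ex (resampleLE_coarser p hp0 hp1 c g hf0 hal)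
      (fun e x => tied_nonneg (c e) (hp0 e) (hp1 e) x) (fun e x => tied_nonneg (g e ∘ c e) (hp0 e) (hp1 e) x)
      hT C⟩

/-! ### The two extreme patterns: one sample, and `n` independent samples -/

/-- **All copies tied** (one coin per coordinate, `K = Unit`): `𝓔 = E_p[∏_l f_l]`, the ONE-SAMPLE
expectation of the product. [cite: DubeySahi2025, Theorem E (proof: `𝓔(Π′,p,F) = E(f₁f₂, μ)`)] -/
theorem ex_allTied (f : L → (ι → Bool) → ℝ) :
    Ex (fun e => tied (fun _ : L => ()) (p e)) (prodFun f) = Ex (bern p) (fun h => ∏ l, f l h) := by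
  have hw : (fun e => tied (fun _ : L => ()) (p e)) =
      pushWeights (fun (_ : ι) (y : Unit → Bool) => y ∘ (fun _ : L => ()))
        (fun e (y : Unit → Bool) => ∏ k, Richards.bw (p e) (y k)) :=
    tied_eq_pushWeights (fun _ => fun _ : L => ()) p
  rw [hw, ex_pushWeights]
  -- the remaining alphabet is `Unit → Bool`; identify it with `Bool`
  unfold Ex
  refine Fintype.sum_equiv (Equiv.piCongrRight fun _ : ι => Equiv.funUnique Unit Bool) _ _ fun C' => ?_
  simp only [Equiv.piCongrRight_apply, Equiv.funUnique_apply]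
  congr 1
  refine prod_congr rfl fun i _ => ?_
  rw [Fintype.prod_unique]
  rfl

/-- **Every copy free** (`c = id`: each copy its own coin): the tied law is the product of Bernoulli
weights over the copies. [folklore] -/
theorem tied_id (q : ℝ) (x : L → Bool) : tied (id : L → L) q x = ∏ l, Richards.bw q (x l) := by
  unfold tied
  rw [show (∑ y : L → Bool, (∏ k, Richards.bw q (y k)) * (if x = y ∘ id then (1 : ℝ) else 0)) =
      ∑ y : L → Bool, (if x = y then ∏ k, Richards.bw q (y k) else 0) from
    sum_congr rfl fun y _ => by simp only [Function.comp_id]; split_ifs <;> simp]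
  rw [sum_ite_eq univ x]
  simp

/-- **All copies free**: `𝓔 = ∏_l E_p[f_l]`, the product of the one-sample expectations (Fubini).
[cite: DubeySahi2025, Theorem E (proof: `𝓔(Π,p,F) = E(f₁,μ)E(f₂,μ)`)] -/
theorem ex_allFree (f : L → (ι → Bool) → ℝ) :
    Ex (fun e => tied (id : L → L) (p e)) (prodFun f) = ∏ l, Ex (bern p) (f l) := by
  unfold Ex prodFun
  simp_rw [tied_id]
  -- swap the two indices of the joint configuration: `(ι → L → Bool) ≃ (L → ι → Bool)`
  rw [← Fintype.sum_equiv (Equiv.piComm fun (_ : L) (_ : ι) => Bool)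
    (fun C' : L → ι → Bool => (∏ i, ∏ l, Richards.bw (p i) (C' l i)) * ∏ l, f l (C' l)) _
    (fun C' => by rfl)]
  -- now factorise over the copies
  simp_rw [prod_comm (s := (univ : Finset ι)) (t := (univ : Finset L)), ← prod_mul_distrib]
  exact (Fintype.prod_sum (fun l (C : ι → Bool) => (∏ i, bern p i (C i)) * f l C)).symm

/-- Any pattern is coarser than "every copy free" and finer than "all copies tied": hence
**`∏_l E_p[f_l] ≤ 𝓔(Π,p,F) ≤ E_p[∏_l f_l]`** for every tying pattern `Π` and every aligned nonnegative
tuple. [cite: DubeySahi2025, Theorem D and Theorem E] -/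
theorem prod_ex_le_ex_tied_le_ex_prod (hp0 : ∀ i, 0 ≤ p i) (hp1 : ∀ i, p i ≤ 1) (c : ι → L → K)
    {f : L → (ι → Bool) → ℝ} (hf0 : ∀ l h, 0 ≤ f l h) (hal : Aligned f) :
    ∏ l, Ex (bern p) (f l) ≤ Ex (fun e => tied (c e) (p e)) (prodFun f) ∧
      Ex (fun e => tied (c e) (p e)) (prodFun f) ≤ Ex (bern p) (fun h => ∏ l, f l h) := by
  constructor
  · rw [← ex_allFree p f]
    exact thmD p hp0 hp1 (fun _ => (id : L → L)) c hf0 hal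
  · rw [← ex_allTied p f]
    exact thmD p hp0 hp1 c (fun _ (_ : K) => ()) hf0 hal

/-- **Theorem E for `n` functions (the `n`-function Harris inequality of Dubey–Sahi)**: for an aligned
tuple of nonnegative functions and a product of Bernoulli measures, `∏_l E[f_l] ≤ E[∏_l f_l]`; for
`n = 2` this is Harris' inequality `E(f₁f₂) ≥ E(f₁)E(f₂)`. [cite: DubeySahi2025, Theorem E and Theorem D] -/
theorem harris_prod (hp0 : ∀ i, 0 ≤ p i) (hp1 : ∀ i, p i ≤ 1) {f : L → (ι → Bool) → ℝ}
    (hf0 : ∀ l h, 0 ≤ f l h) (hal : Aligned f) :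
    ∏ l, Ex (bern p) (f l) ≤ Ex (bern p) (fun h => ∏ l, f l h) := by
  have h := prod_ex_le_ex_tied_le_ex_prod p hp0 hp1 (fun _ => (id : L → L)) hf0 hal
  exact h.1.trans h.2

end Tying

end DecisionTree

end Literature.Probability.Percolation

end
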